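import Summits.ResolutionOfSingularities.ResolutionOfSingularities.Theorems.ValuativeLuAlphaPTorsorPthPowerModMonomialJacobian
import Literature.AlgebraicGeometry.Resolution.RegularQuotientIdeal

/-!
# Dual derivations of a regular local ring presented as a quotient of `k[X]_𝔮`

Helper file for the stub `stub_pthPowerModMonomial` of the line `pfaff-line-log-final-forms`
(crux `Valuative.LuAlphaPTorsor`, item `stmt-ResolutionOfSingularities-0641`).

Setting: `S = k[X_1, …, X_n]` over a field `k`, `𝔮` a prime of `S`, `Q = S_𝔮` (a regular local
ring), and a SURJECTIVE ring homomorphism `Φq : Q → R` onto a regular local ring `R` (so `R` is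
the local ring of a point of a `k`-scheme of finite type; we write `Φ = Φq ∘ (S → Q)`).

* `isUnit_of_isUnit_map`, `map_mem_maximalIdeal` — `Φq` is a local homomorphism.
* `span_setOf_eq_ker` — `ker Φq` is generated by the images of polynomials it contains.
* `linearIndependent_toCotangent_append` — if `f_1, …, f_c ∈ ker Φq` have independent
  classes in `𝔫/𝔫²` (`𝔫 = 𝔪_Q`) and `Φq(F_1), …, Φq(F_d)` have independent classes in
  `𝔪_R/𝔪_R²`, then `f_1, …, f_c, F_1, …, F_d` have independent classes in `𝔫/𝔫²`.
* `exists_jacobian_data` — **the Jacobian data**: polynomials `g_1, …, g_c ∈ ker Φ` generating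
  `ker Φq` (the tree's `exists_span_eq_of_isRegularLocalRing_quotient`: the ideal of a regular
  quotient of a regular local ring is generated by elements with independent differentials) and
  derivations `D̃_1, …, D̃_{c+d} ∈ Der(Q)` DUAL to `(g_1, …, g_c, F_1, …, F_d)`
  (`D̃_m(g'_{m'}) = δ_{mm'}`), obtained from the Jacobian supply
  `exists_derivations_apply_sub_mem` (a matrix `(D_l g'_m) ≡ c₀ · 1 mod 𝔮` is invertible over
  `Q`).
* `exists_derivation_descend` — a derivation of `Q` killing the `g_i` descends to `R`.
* `exists_dual_derivations` — **dual derivations**: `D_1, …, D_d ∈ Der_ℤ(R)` with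
  `D_i(Φ F_j) = δ_ij`.
-/

set_option linter.dupNamespace false

attribute [local instance 1100] Ring.toIntAlgebra AddCommGroup.toIntModule

namespace Summit.ResolutionOfSingularities.ResolutionOfSingularities.Theorems.PfaffLine

open IsLocalRing MvPolynomial Literature.AlgebraicGeometry.Resolution

universe u v

/-! ## A surjection of local rings is local -/

section LocalHom

variable {Q : Type v} [CommRing Q] [IsLocalRing Q] {R : Type u} [CommRing R] [IsLocalRing R]
  (φ : Q →+* R) (hφ : Function.Surjective φ)

include hφ

/-- A surjective homomorphism of local rings reflects units. [folklore] -/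
theorem isUnit_of_isUnit_map {z : Q} (hz : IsUnit (φ z)) : IsUnit z :=
  haveI := IsLocalHom.of_surjective φ hφ
  IsUnit.of_map φ z hz

/-- A surjective homomorphism of local rings maps the maximal ideal into the maximal ideal.
[folklore] -/
theorem map_mem_maximalIdeal {z : Q} (hz : z ∈ maximalIdeal Q) : φ z ∈ maximalIdeal R :=
  (mem_maximalIdeal _).mpr fun hu => (mem_maximalIdeal _).mp hz (isUnit_of_isUnit_map φ hφ hu)

/-- … and `𝔫²` into `𝔪²`. [folklore] -/
theorem map_mem_sq_maximalIdeal {z : Q} (hz : z ∈ maximalIdeal Q ^ 2) :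
    φ z ∈ maximalIdeal R ^ 2 := by
  have h1 : (maximalIdeal Q).map φ ≤ maximalIdeal R :=
    Ideal.map_le_iff_le_comap.mpr fun z hz => map_mem_maximalIdeal φ hφ hz
  have h2 := Ideal.mem_map_of_mem φ hz
  rw [Ideal.map_pow] at h2
  exact Ideal.pow_right_mono h1 2 h2

/-- **Independence of differentials lifts along a surjection of local rings.** If
`f_1, …, f_c ∈ ker φ` have linearly independent classes in `𝔫/𝔫²` and the images
`φ(f'_1), …, φ(f'_d)` have linearly independent classes in `𝔪/𝔪²`, then
`f_1, …, f_c, f'_1, …, f'_d` have linearly independent classes in `𝔫/𝔫²`. [folklore] -/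
theorem linearIndependent_toCotangent_append {c : ℕ} (f : Fin c → Q)
    (hf : ∀ i, f i ∈ maximalIdeal Q) (hf0 : ∀ i, φ (f i) = 0)
    (hli : LinearIndependent (ResidueField Q) fun i => (maximalIdeal Q).toCotangent ⟨f i, hf i⟩)
    {d : ℕ} (f₂ : Fin d → Q) (hm : ∀ j, φ (f₂ j) ∈ maximalIdeal R)
    (hli₂ : LinearIndependent (ResidueField R) fun j =>
      (maximalIdeal R).toCotangent ⟨φ (f₂ j), hm j⟩)
    (happ : ∀ m, Fin.append f f₂ m ∈ maximalIdeal Q) :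
    LinearIndependent (ResidueField Q) fun m =>
      (maximalIdeal Q).toCotangent ⟨Fin.append f f₂ m, happ m⟩ := by
  classical
  rw [Fintype.linearIndependent_iff]
  intro gc hsum
  choose a ha using fun m => residue_surjective (R := Q) (gc m)
  -- `∑ a_m f'_m ∈ 𝔫²`
  have hmem : ∑ m, a m * Fin.append f f₂ m ∈ maximalIdeal Q ^ 2 := by
    have h1 : ∑ m, gc m • (maximalIdeal Q).toCotangent ⟨Fin.append f f₂ m, happ m⟩ =
        (maximalIdeal Q).toCotangent (∑ m, a m • ⟨Fin.append f f₂ m, happ m⟩) := by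
      rw [map_sum]
      refine Finset.sum_congr rfl fun m _ => ?_
      rw [← ha m, LinearMap.map_smul_of_tower]
      exact algebraMap_smul (ResidueField Q) (a m) _
    rw [h1, Ideal.toCotangent_eq_zero] at hsum
    simpa only [AddSubmonoidClass.coe_finsetSum, SetLike.val_smul, smul_eq_mul] using hsum
  -- apply `φ`: `∑_j φ(a_{c+j}) φ(f₂ j) ∈ 𝔪²`, so `a_{c+j} ∈ 𝔫`
  have hmem₂ : ∑ j, φ (a (Fin.natAdd c j)) * φ (f₂ j) ∈ maximalIdeal R ^ 2 := by
    have h := map_mem_sq_maximalIdeal φ hφ hmem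
    rw [map_sum, Fin.sum_univ_add] at h
    simpa only [map_mul, Fin.append_left, hf0, mul_zero, Finset.sum_const_zero, zero_add,
      Fin.append_right] using h
  have ha₂ : ∀ j, gc (Fin.natAdd c j) = 0 := by
    have hzero := Fintype.linearIndependent_iff.mp hli₂ (fun j => residue R (φ (a (Fin.natAdd c j))))
      (by
        have h1 : ∑ j, residue R (φ (a (Fin.natAdd c j))) •
            (maximalIdeal R).toCotangent ⟨φ (f₂ j), hm j⟩ =
            (maximalIdeal R).toCotangent (∑ j, φ (a (Fin.natAdd c j)) • ⟨φ (f₂ j), hm j⟩) := by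
          rw [map_sum]
          refine Finset.sum_congr rfl fun j _ => ?_
          rw [LinearMap.map_smul_of_tower]
          exact algebraMap_smul (ResidueField R) _ _
        rw [h1, Ideal.toCotangent_eq_zero]
        simpa only [AddSubmonoidClass.coe_finsetSum, SetLike.val_smul, smul_eq_mul] using hmem₂)
    intro j
    have h1 : φ (a (Fin.natAdd c j)) ∈ maximalIdeal R := (residue_eq_zero_iff _).mp (hzero j)
    have h2 : a (Fin.natAdd c j) ∈ maximalIdeal Q :=
      (mem_maximalIdeal _).mpr fun hu => (mem_maximalIdeal _).mp h1 (hu.map φ)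
    rw [← ha, residue_eq_zero_iff]
    exact h2
  -- the relation now only involves `f`, so `hli` finishes
  have ha₁ : ∀ i, gc (Fin.castAdd d i) = 0 := by
    refine Fintype.linearIndependent_iff.mp hli (fun i => gc (Fin.castAdd d i)) ?_
    rw [Fin.sum_univ_add] at hsum
    have h0 : ∑ j, gc (Fin.natAdd c j) •
        (maximalIdeal Q).toCotangent ⟨Fin.append f f₂ (Fin.natAdd c j), happ _⟩ = 0 :=
      Finset.sum_eq_zero fun j _ => by rw [ha₂ j, zero_smul]
    rw [h0, add_zero] at hsum
    convert hsum using 2 with i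
    congr 2
    exact Subtype.ext (Fin.append_left f f₂ i).symm
  intro m
  induction m using Fin.addCases with
  | left i => exact ha₁ i
  | right j => exact ha₂ j

end LocalHom

/-! ## The Jacobian data of a presentation `k[X]_𝔮 ↠ R` -/

section Presentation

variable (k : Type u) [Field k] (n : ℕ) {R : Type u} [CommRing R] [Algebra ℤ R]
  [IsRegularLocalRing R] (𝔮 : Ideal (MvPolynomial (Fin n) k)) [𝔮.IsPrime]
  (Φq : Localization.AtPrime 𝔮 →+* R) (hsurj : Function.Surjective Φq)

omit [Algebra ℤ R] [IsRegularLocalRing R] in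
/-- `ker Φq` is generated by the images `g/1` of the polynomials `g` it contains
(`g/s = (g/1)(1/s)`). [folklore] -/
theorem span_setOf_eq_ker :
    Ideal.span {z | Φq z = 0 ∧ ∃ F : MvPolynomial (Fin n) k, algebraMap _ (Localization.AtPrime 𝔮) F = z} =
      RingHom.ker Φq := by
  apply le_antisymm
  · rw [Ideal.span_le]
    rintro z ⟨hz, -⟩
    exact hz
  · intro z hz
    obtain ⟨⟨F, s⟩, rfl⟩ := IsLocalization.mk'_surjective 𝔮.primeCompl z
    dsimp only at hz ⊢
    rw [RingHom.mem_ker] at hz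
    have hF : Φq (algebraMap _ (Localization.AtPrime 𝔮) F) = 0 := by
      rw [← IsLocalization.mk'_spec (Localization.AtPrime 𝔮) F s, map_mul, hz, zero_mul]
    rw [IsLocalization.mk'_eq_mul_mk'_one]
    exact Ideal.mul_mem_right _ _ (Ideal.subset_span ⟨hF, F, rfl⟩)

include hsurj

omit [Algebra ℤ R] in
/-- **The Jacobian data.** For polynomials `F_1, …, F_d` whose images `Φ(F_j) ∈ 𝔪_R` have
linearly independent classes in `𝔪_R/𝔪_R²`, there are polynomials `g_1, …, g_c ∈ ker Φ`
with `(g_1/1, …, g_c/1) = ker Φq` and derivations `D̃_1, …, D̃_{c+d}` of `Q = k[X]_𝔮` dual to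
`g' = (g_1, …, g_c, F_1, …, F_d)`: `D̃_m(g'_{m'}/1) = δ_{mm'}`. (The `g_i` are given by the
regularity of `R = Q/ker Φq`; the `D̃_m` by inverting the matrix `(D_l(g'_m))`, congruent to
`c₀ · 1` modulo `𝔮`, of the Jacobian supply `D_l ∈ Der(k[X])` extended to `Q`.)
(Matsumura, *Commutative Ring Theory*, proof of Thm. 30.5, with Thm. 14.2.) [folklore] -/
theorem exists_jacobian_data {d : ℕ} (F : Fin d → MvPolynomial (Fin n) k)
    (hFm : ∀ j, Φq (algebraMap _ _ (F j)) ∈ maximalIdeal R)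
    (hliF : LinearIndependent (ResidueField R) fun j =>
      (maximalIdeal R).toCotangent ⟨_, hFm j⟩) :
    ∃ (c : ℕ) (g : Fin c → MvPolynomial (Fin n) k)
      (Dt : Fin (c + d) → Derivation ℤ (Localization.AtPrime 𝔮) (Localization.AtPrime 𝔮)),
      (∀ i, Φq (algebraMap _ _ (g i)) = 0) ∧
      Ideal.span (Set.range fun i => algebraMap _ (Localization.AtPrime 𝔮) (g i)) =
        RingHom.ker Φq ∧
      ∀ m m', Dt m (algebraMap _ _ (Fin.append g F m')) = if m = m' then 1 else 0 := by
  classical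
  haveI hreg : IsRegularLocalRing (Localization.AtPrime 𝔮) := inferInstance
  -- the ideal of the regular quotient `R` is generated by polynomials with independent differentials
  have hJ : RingHom.ker Φq ≤ maximalIdeal (Localization.AtPrime 𝔮) :=
    IsLocalRing.le_maximalIdeal (RingHom.ker_ne_top Φq)
  haveI : IsRegularLocalRing (Localization.AtPrime 𝔮 ⧸ RingHom.ker Φq) :=
    IsRegularLocalRing.of_ringEquiv (RingHom.quotientKerEquivOfSurjective hsurj).symm
  obtain ⟨c, f, hfG, hspan, hli⟩ := exists_span_eq_of_isRegularLocalRing_quotient hJ _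
    (span_setOf_eq_ker k n 𝔮 Φq)
  choose g hg using fun i => (hfG i).2
  have hf0 : ∀ i, Φq (f i) = 0 := fun i => (hfG i).1
  have hf : ∀ i, f i ∈ maximalIdeal (Localization.AtPrime 𝔮) := fun i => hJ (hf0 i)
  -- the lifts `F_j/1` of the given elements
  set f₂ : Fin d → Localization.AtPrime 𝔮 := fun j => algebraMap _ _ (F j) with hf₂
  have happ' : ∀ m, algebraMap _ (Localization.AtPrime 𝔮) (Fin.append g F m) =
      Fin.append f f₂ m := by
    intro m
    induction m using Fin.addCases with
    | left i => rw [Fin.append_left, Fin.append_left, hg]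
    | right j => rw [Fin.append_right, Fin.append_right]
  have happ : ∀ m, Fin.append f f₂ m ∈ maximalIdeal (Localization.AtPrime 𝔮) := by
    intro m
    induction m using Fin.addCases with
    | left i => rw [Fin.append_left]; exact hf i
    | right j =>
      rw [Fin.append_right]
      exact (mem_maximalIdeal _).mpr fun hu => (mem_maximalIdeal _).mp (hFm j) (hu.map Φq)
  have hli' := linearIndependent_toCotangent_append Φq hsurj f hf hf0 hli f₂ hFm hliF happ
  have hgm : ∀ m, algebraMap _ (Localization.AtPrime 𝔮) (Fin.append g F m) ∈
      maximalIdeal (Localization.AtPrime 𝔮) := fun m => (happ' m) ▸ happ m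
  have hli'' : LinearIndependent 𝔮.ResidueField fun m =>
      (maximalIdeal (Localization.AtPrime 𝔮)).toCotangent ⟨_, hgm m⟩ := by
    have heq : (fun m => (maximalIdeal (Localization.AtPrime 𝔮)).toCotangent ⟨_, hgm m⟩) =
        fun m => (maximalIdeal (Localization.AtPrime 𝔮)).toCotangent ⟨_, happ m⟩ :=
      funext fun m => congrArg _ (Subtype.ext (happ' m))
    rw [heq]
    exact hli'
  -- the Jacobian supply, extended to `Q`
  obtain ⟨Dv, c₀, hc₀, hDv⟩ := exists_derivations_apply_sub_mem k n 𝔮 (Fin.append g F) hgm hli''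
  choose DQ hDQ using fun l => exists_derivation_localization 𝔮 (Dv l)
  set G : Matrix (Fin (c + d)) (Fin (c + d)) (Localization.AtPrime 𝔮) :=
    Matrix.of fun l m => DQ l (algebraMap _ _ (Fin.append g F m)) with hG
  -- `G ≡ c₀ · 1 mod 𝔫`, so `det G` is a unit
  have hres : G.map (residue (Localization.AtPrime 𝔮)) =
      Matrix.diagonal fun _ => residue _ (algebraMap _ (Localization.AtPrime 𝔮) c₀) := by
    ext l m
    rw [Matrix.map_apply, hG, Matrix.of_apply, hDQ, Matrix.diagonal_apply]
    have h1 : residue _ (algebraMap _ (Localization.AtPrime 𝔮) (Dv l (Fin.append g F m))) =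
        residue _ (algebraMap _ (Localization.AtPrime 𝔮) (if m = l then c₀ else 0)) := by
      rw [← sub_eq_zero, ← map_sub, ← map_sub, residue_eq_zero_iff]
      exact (IsLocalization.AtPrime.to_map_mem_maximal_iff _ 𝔮 _).mpr (hDv l m)
    rw [h1]
    by_cases hlm : l = m
    · subst hlm; rw [if_pos rfl, if_pos rfl]
    · rw [if_neg (Ne.symm hlm), if_neg hlm, map_zero, map_zero]
  have hdet : IsUnit G.det := by
    rw [← residue_ne_zero_iff_isUnit, RingHom.map_det, RingHom.mapMatrix_apply, hres,
      Matrix.det_diagonal, Finset.prod_const]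
    refine pow_ne_zero _ ?_
    rw [Ne, residue_eq_zero_iff, IsLocalization.AtPrime.to_map_mem_maximal_iff _ 𝔮]
    exact hc₀
  -- `D̃ = G⁻¹ · DQ`
  refine ⟨c, g, fun m => ∑ l, G⁻¹ m l • DQ l, fun i => by rw [hg]; exact hf0 i, ?_, fun m m' => ?_⟩
  · rw [← hspan]
    congr 1
    exact congrArg Set.range (funext hg)
  · rw [sum_derivation_apply]
    simp only [Derivation.smul_apply, smul_eq_mul]
    have h := congrFun (congrFun (Matrix.nonsing_inv_mul G hdet) m) m'
    rw [Matrix.mul_apply, Matrix.one_apply] at h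
    rw [← h]
    rfl

omit [IsRegularLocalRing R] in
/-- **Descent.** A derivation of `Q` killing the generators `g_i/1` of `ker Φq` preserves
`ker Φq` and descends to `R`. [folklore] -/
theorem exists_derivation_descend {c : ℕ} (g : Fin c → MvPolynomial (Fin n) k)
    (hspan : Ideal.span (Set.range fun i => algebraMap _ (Localization.AtPrime 𝔮) (g i)) =
      RingHom.ker Φq)
    (Δ : Derivation ℤ (Localization.AtPrime 𝔮) (Localization.AtPrime 𝔮))
    (hΔ : ∀ i, Δ (algebraMap _ _ (g i)) = 0) :
    ∃ Δ' : Derivation ℤ R R, ∀ z, Δ' (Φq z) = Φq (Δ z) := by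
  refine exists_derivation_of_surjective Φq hsurj Δ fun z hz => ?_
  have hz' : z ∈ Ideal.span (Set.range fun i => algebraMap _ (Localization.AtPrime 𝔮) (g i)) := by
    rw [hspan]; exact hz
  refine Submodule.span_induction (p := fun z _ => Φq (Δ z) = 0) ?_ (by simp) ?_ ?_ hz'
  · rintro _ ⟨i, rfl⟩
    rw [hΔ, map_zero]
  · intro x y _ _ hx hy
    rw [map_add, map_add, hx, hy, add_zero]
  · intro a x hx hax
    have hx0 : Φq x = 0 := by rw [← RingHom.mem_ker, ← hspan]; exact hx
    rw [smul_eq_mul, Derivation.leibniz, map_add, smul_eq_mul, smul_eq_mul, map_mul, map_mul,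
      hax, hx0, mul_zero, zero_mul, add_zero]

/-- **Dual derivations.** If `Φ(F_1), …, Φ(F_d) ∈ 𝔪_R` have linearly independent classes in
`𝔪_R/𝔪_R²` (e.g. form a regular system of parameters of `R`), there are `ℤ`-derivations
`D_1, …, D_d` of `R` with `D_i(Φ F_j) = δ_ij`. (Matsumura, *Commutative Ring Theory*, proof of Thm. 30.5.) [folklore] -/
theorem exists_dual_derivations {d : ℕ} (F : Fin d → MvPolynomial (Fin n) k)
    (hFm : ∀ j, Φq (algebraMap _ _ (F j)) ∈ maximalIdeal R)
    (hliF : LinearIndependent (ResidueField R) fun j =>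
      (maximalIdeal R).toCotangent ⟨_, hFm j⟩) :
    ∃ D : Fin d → Derivation ℤ R R,
      ∀ i j, D i (Φq (algebraMap _ _ (F j))) = if i = j then 1 else 0 := by
  obtain ⟨c, g, Dt, hg0, hspan, hDt⟩ := exists_jacobian_data k n 𝔮 Φq hsurj F hFm hliF
  have key : ∀ i : Fin d, ∃ D : Derivation ℤ R R,
      ∀ j, D (Φq (algebraMap _ _ (F j))) = if i = j then 1 else 0 := by
    intro i
    obtain ⟨D, hD⟩ := exists_derivation_descend k n 𝔮 Φq hsurj g hspan (Dt (Fin.natAdd c i))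
      fun i' => by
        have h := hDt (Fin.natAdd c i) (Fin.castAdd d i')
        rw [Fin.append_left] at h
        rw [h, if_neg]
        intro h'
        have := congrArg Fin.val h'
        simp only [Fin.val_natAdd, Fin.val_castAdd] at this
        omega
    refine ⟨D, fun j => ?_⟩
    have h := hDt (Fin.natAdd c i) (Fin.natAdd c j)
    rw [Fin.append_right] at h
    rw [hD, h]
    by_cases hij : i = j
    · subst hij; simp
    · rw [if_neg (fun hq => hij ((Fin.natAdd_inj c).mp hq)), if_neg hij, map_zero]
  choose D hD using key
  exact ⟨D, hD⟩

end Presentation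

/-- **Registered sub-goal `pthPowerModMonomial_dual_derivations`** (closed form of
`exists_dual_derivations` in universe `0`, for `--supports` registration): dual derivations of a
regular local quotient of `k[X]_𝔮`. [folklore] -/
theorem pthPowerModMonomial_dual_derivations : ∀ (k : Type) [Field k] (n : ℕ) {R : Type} [CommRing R] [Algebra ℤ R] [IsRegularLocalRing R] (𝔮 : Ideal (MvPolynomial (Fin n) k)) [𝔮.IsPrime] (Φq : Localization.AtPrime 𝔮 →+* R), Function.Surjective Φq → ∀ {d : ℕ} (F : Fin d → MvPolynomial (Fin n) k) (hFm : ∀ j, Φq (algebraMap (MvPolynomial (Fin n) k) (Localization.AtPrime 𝔮) (F j)) ∈ IsLocalRing.maximalIdeal R), LinearIndependent (IsLocalRing.ResidueField R) (fun j => (IsLocalRing.maximalIdeal R).toCotangent ⟨Φq (algebraMap (MvPolynomial (Fin n) k) (Localization.AtPrime 𝔮) (F j)), hFm j⟩) → ∃ D : Fin d → Derivation ℤ R R, ∀ i j, D i (Φq (algebraMap (MvPolynomial (Fin n) k) (Localization.AtPrime 𝔮) (F j))) = if i = j then 1 else 0 :=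
  fun k _ n _ _ _ _ 𝔮 _ Φq hsurj _ F hFm hliF => exists_dual_derivations k n 𝔮 Φq hsurj F hFm hliF

end Summit.ResolutionOfSingularities.ResolutionOfSingularities.Theorems.PfaffLine
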